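import Summits.RiemannHypothesis.RiemannHypothesis.Theses.RobinStaircase
import Literature.NumberTheory.LFunctions.NicolasOmega
import HarnessLib

/-!
# `RobinStaircase.RobinCriterionRL` (item stmt-RiemannHypothesis-22083) — closer by a tree theorem

`(∀ n > 5040, robinInequality n) → RiemannHypothesis` is Robin's criterion, direction ⇐ (Robin 1984, §4
Prop. 1 + Thm. 1), UNCONDITIONAL in the tree as
`Literature.NumberTheory.LFunctions.riemannHypothesis_of_robinInequality` (`NicolasOmega.lean`).
Cell rh-split (typer-3 g3 glue sweep, RULING #374).  Pure propositional glue; no analysis.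
Nothing here bears on the truth of RH.
-/

set_option linter.dupNamespace false  -- the mandated namespace repeats `RiemannHypothesis`

namespace Summit.RiemannHypothesis.RiemannHypothesis.Theorems.RobinStaircase

/-- **`RobinCriterionRL` (item stmt-RiemannHypothesis-22083) holds**: Robin's inequality for all
`n > 5040` implies RH — Robin 1984, direction ⇐ (§4 Prop. 1 with Thm. 1), UNCONDITIONAL in the tree and
cited here BY NAME: `Literature.NumberTheory.LFunctions.riemannHypothesis_of_robinInequality`
(`Literature/NumberTheory/LFunctions/NicolasOmega.lean`). A crux that is a tree theorem: genuine dedup,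
zero new content. [folklore] -/
theorem robinCriterionRL_proof : Summit.RiemannHypothesis.RiemannHypothesis.Theses.RobinStaircase.RobinCriterionRL :=
  fun h => Literature.NumberTheory.LFunctions.riemannHypothesis_of_robinInequality h

end Summit.RiemannHypothesis.RiemannHypothesis.Theorems.RobinStaircase
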